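import Summits.BirchSwinnertonDyer.BirchSwinnertonDyer.Theorems.LeadingTermConsistencyCells
import Summits.BirchSwinnertonDyer.BirchSwinnertonDyer.Theorems.LeadingTermKatoCorankBound
import Summits.BirchSwinnertonDyer.BirchSwinnertonDyer.Theorems.LeadingTermConsistencyStubDeficientTwoLeMatch
import HarnessLib

/-!
# BirchSwinnertonDyer / LeadingTerm — support item `ConsistencyOfKato` (stmt-BirchSwinnertonDyer-16799):
# what the glue item reduces to

`Summit.BirchSwinnertonDyer.BirchSwinnertonDyer.Theses.LeadingTerm.ConsistencyOfKato :=
KatoDivisibility → SqueezeUBR2 → RankLeOne → Consistency` is the CONDITIONAL FORM of crux #2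
`Consistency` (stmt-BirchSwinnertonDyer-16217) delivered by its line `Sketch`: Kato's divisibility
(crux #5, stmt-18082) → no excess rank (crux #4) → the known rank-`≤ 1` slice (support `RankLeOne`,
stmt-16219) → `Consistency`.

This file records, sorry-free, exactly what the item is worth and what it waits on:

* `leadingTerm_consistencyOfKato_of_consistency` — the item is implied by the crux `Consistency`
  itself (the three premises are then idle), so it can never be harder than stmt-16217.
* `leadingTerm_padicOrderKatoSideR2_of_katoDivisibility` — the Kato chain of the route, composed:
  `KatoDivisibility → KatoCorankBound → PAdicOrderKatoSideR2` (both links are tree theorems of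
  `LeadingTermKatoCorankBound`: Greenberg's `corank Sel ≤ rank X/TX ≤ ord_T g ≤ ord_T L_p`, then the
  Kummer corank identity).
* `leadingTerm_consistencyOfKato_iff_stubs` — EXACTNESS: the item is EQUIVALENT to
  "`KatoDivisibility`, `SqueezeUBR2`, `RankLeOne` imply S1a ∧ S1b ∧ S2", the three registered open
  stubs of line `Sketch` of crux #2 — S1a (deficient cell `(1, odd ≥ 3)`), S1b (deficient cells
  `2 ≤ r_MW < r_an` of matched parity), S2 (diagonal `r_MW = r_an ≥ 2`, the rank-`≥ 2` `p`-adic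
  Beilinson formula) — by the landed bookkeeping `consistency_of_open_stubs` /
  `open_stubs_of_consistency`, the `PAdicOrderKatoSideR2` input being discharged from the item's own
  premise `KatoDivisibility`; so its open residue is precisely that of crux #2's line.
* `leadingTerm_consistencyOfKato_of_stubs` — the one-line closing form: S1a → S1b → S2 → item.
* `leadingTerm_consistencyOfKato_of_deficientVanishing_of_diagonal` — the item from DEFICIENT
  VANISHING (`1 ≤ r_MW < r_an ⇒ [T^{r_MW}]L_p = 0`, the restatement of crux #2 recommended by its
  lead) and S2.
* `leadingTerm_consistencyOfKato_of_selmerSide_of_diagonal` — through ITEMS: with `KatoDivisibility`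
  as a premise, route SelmerRank's items `SelmerRankLB` (stmt-0131) and `SelmerRankSmallImage`
  (stmt-14418) give deficient vanishing (`deficient_coeff_eq_zero_of_items`: `r_MW < r_an ≤
  corank Sel_{p^∞} ≤ ord_T L_p`), S1a included, leaving the single stub S2.

Nothing here closes the item: S2 (and S1b) are open mathematics, so stmt-16799 waits on crux
stmt-16217 exactly as the planner filed it.
-/

set_option linter.dupNamespace false

namespace Summit.BirchSwinnertonDyer.BirchSwinnertonDyer.Theorems

open scoped MatrixGroups ModularForm
open CongruenceSubgroup Literature.NumberTheory.EllipticCurves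
  Literature.NumberTheory.EllipticCurves.ModularForms WeierstrassCurve
open Summit.BirchSwinnertonDyer.BirchSwinnertonDyer.Theses.LeadingTerm

/-- **The glue item is implied by the crux.** `Consistency → ConsistencyOfKato`: the premises
`KatoDivisibility`, `SqueezeUBR2`, `RankLeOne` are simply discarded. Hence stmt-16799 closes the
moment crux #2 (stmt-BirchSwinnertonDyer-16217) does, and is never harder. [folklore] -/
theorem leadingTerm_consistencyOfKato_of_consistency (hC : Consistency) : ConsistencyOfKato :=
  fun _ _ _ => hC

/-- **The route's Kato chain, composed**: Kato's divisibility `char_Λ X(E/ℚ_∞) ∣ p^n L_p(E,T)`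
(crux #5 `KatoDivisibility`, K. Kato, Astérisque 295 (2004), Thm 17.4 (1)–(2), p. 273) implies the
rank bound `rank E(ℚ) ≤ ord_{T=0} L_p(E,T)` (`PAdicOrderKatoSideR2`, Thm 18.4, p. 281) through the
corank bound `KatoCorankBound`: both links are the tree theorems
`leadingTerm_katoCorankBound_of_katoDivisibility` (Greenberg LNM 1716 Lemma 3.1:
`corank Sel_{p^∞}(E/ℚ) ≤ rank_{ℤ_p} X/TX ≤ ord_T g ≤ ord_T ι g = ord_T L_p`) and
`leadingTerm_padicOrderKatoSideR2_of_katoCorankBound` (Kummer: `rank ≤ corank Sel_{p^∞}`).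
[cite: Kato2004Asterisque, Thm 17.4 (p. 273) and Thm 18.4 (p. 281)] -/
theorem leadingTerm_padicOrderKatoSideR2_of_katoDivisibility (hK : KatoDivisibility) :
    PAdicOrderKatoSideR2 :=
  leadingTerm_padicOrderKatoSideR2_of_katoCorankBound
    (leadingTerm_katoCorankBound_of_katoDivisibility hK)

/-- **Exactness of the reduction.** `ConsistencyOfKato` is EQUIVALENT to: the item's three premises
`KatoDivisibility`, `SqueezeUBR2`, `RankLeOne` imply the conjunction S1a ∧ S1b ∧ S2 of the
registered stubs of line `Sketch` of crux #2 (`Cruxes/Consistency/Lines/Sketch.lean`, verbatim: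
S1a `stub_deficient_one_odd` — cell `r_MW = 1`, `r_an` odd `≥ 3`: `[T¹]L_p = 0`, known in print by
Perrin-Riou's torsion transfer; S1b `stub_deficient_two_le_match` — cells `2 ≤ r_MW < r_an` of
matched parity: `[T^{r_MW}]L_p = 0`, open from `(2,4)`; S2 `stub_diagonal_two_le` — diagonal
`r_MW = r_an ≥ 2`: the rank-`≥ 2` `p`-adic Beilinson formula with ONE rational `q`, open).
(→) the premises and the item give `Consistency`, from which `open_stubs_of_consistency` extracts
every stub (deficient cells: the archimedean identity forces `q = 0` since `Ω⁺_f, Reg_∞ > 0`, then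
`log_p γ ≠ 0`; a canonical `D` exists by `exists_isCanonical_holds`); (←) the premise
`KatoDivisibility` goes through the Kato chain to `PAdicOrderKatoSideR2` and the landed composition
`consistency_of_open_stubs` (`LeadingTermConsistencyCells`) applies. So the open residue of
stmt-16799 is literally that of crux stmt-16217's line. [folklore] -/
theorem leadingTerm_consistencyOfKato_iff_stubs :
    ConsistencyOfKato ↔
      (KatoDivisibility → SqueezeUBR2 → RankLeOne →
        (∀ (W : WeierstrassCurve ℚ) [W.IsElliptic] [W.IsGloballyMinimal] (p : ℕ) [Fact p.Prime],
      5 ≤ p → Literature.NumberTheory.EllipticCurves.IsOrdinaryAt W p →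
      ∀ {N : ℕ} [NeZero N] (f : CuspForm (CongruenceSubgroup.Gamma0 N) 2),
        Literature.NumberTheory.EllipticCurves.ModularForms.IsNewformOf W f →
        W.mordellWeilRank = 1 → Odd W.analyticRank → 3 ≤ W.analyticRank →
          PowerSeries.coeff 1 (Literature.NumberTheory.EllipticCurves.padicLFunction f
            (Literature.NumberTheory.EllipticCurves.unitRoot W p : ℚ_[p])) = 0) ∧
        (∀ (W : WeierstrassCurve ℚ) [W.IsElliptic] [W.IsGloballyMinimal] (p : ℕ) [Fact p.Prime],
      5 ≤ p → Literature.NumberTheory.EllipticCurves.IsOrdinaryAt W p →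
      ∀ {N : ℕ} [NeZero N] (f : CuspForm (CongruenceSubgroup.Gamma0 N) 2),
        Literature.NumberTheory.EllipticCurves.ModularForms.IsNewformOf W f →
        2 ≤ W.mordellWeilRank → W.mordellWeilRank < W.analyticRank →
          (Even W.mordellWeilRank ↔ Even W.analyticRank) →
          PowerSeries.coeff W.mordellWeilRank (Literature.NumberTheory.EllipticCurves.padicLFunction f
            (Literature.NumberTheory.EllipticCurves.unitRoot W p : ℚ_[p])) = 0) ∧
        (∀ (W : WeierstrassCurve ℚ) [W.IsElliptic] [W.IsGloballyMinimal] (p : ℕ) [Fact p.Prime],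
      5 ≤ p → Literature.NumberTheory.EllipticCurves.IsOrdinaryAt W p →
      ∀ (D : WeierstrassCurve.PAdicHeightData W p), D.IsCanonical →
      ∀ ⦃N : ℕ⦄ [NeZero N] (f : CuspForm (CongruenceSubgroup.Gamma0 N) 2),
        Literature.NumberTheory.EllipticCurves.ModularForms.IsNewformOf W f →
        2 ≤ W.mordellWeilRank → W.analyticRank = W.mordellWeilRank →
          0 < W.regulator ∧ 0 < Literature.NumberTheory.EllipticCurves.ModularForms.plusPeriod f ∧
          ∃ q : ℚ, iteratedDeriv W.mordellWeilRank W.entireLFunction 1 =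
              (((W.mordellWeilRank.factorial : ℝ) * (q : ℝ) *
                Literature.NumberTheory.EllipticCurves.ModularForms.plusPeriod f * W.regulator : ℝ) : ℂ) ∧
            PowerSeries.coeff W.mordellWeilRank (Literature.NumberTheory.EllipticCurves.padicLFunction f
                (Literature.NumberTheory.EllipticCurves.unitRoot W p : ℚ_[p])) *
              Literature.NumberTheory.EllipticCurves.padicLog p
                (Literature.NumberTheory.EllipticCurves.cyclotomicGenerator p) ^ W.mordellWeilRank =
            (q : ℚ_[p]) * (1 - (Literature.NumberTheory.EllipticCurves.unitRoot W p : ℚ_[p])⁻¹) ^ 2 *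
              WeierstrassCurve.padicRegulator D)) := by
  unfold ConsistencyOfKato
  constructor
  · intro h hK hUB hR1
    obtain ⟨hS1a, -, hS1b, hS2⟩ := open_stubs_of_consistency (h hK hUB hR1)
    exact ⟨hS1a, hS1b, hS2⟩
  · intro h hK hUB hR1
    obtain ⟨hS1a, hS1b, hS2⟩ := h hK hUB hR1
    exact consistency_of_open_stubs hUB hR1 (leadingTerm_padicOrderKatoSideR2_of_katoDivisibility hK)
      hS1a hS1b hS2

/-- **`ConsistencyOfKato` from the three registered stubs of line `Sketch` of crux #2** — the
one-line closing form of `leadingTerm_consistencyOfKato_iff_stubs`: hypotheses S1a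
(`stub_deficient_one_odd`), S1b (`stub_deficient_two_le_match`), S2 (`stub_diagonal_two_le`)
verbatim. When the three stubs land, the item is this theorem applied to them. [folklore] -/
theorem leadingTerm_consistencyOfKato_of_stubs
    (hS1a : ∀ (W : WeierstrassCurve ℚ) [W.IsElliptic] [W.IsGloballyMinimal] (p : ℕ) [Fact p.Prime],
      5 ≤ p → Literature.NumberTheory.EllipticCurves.IsOrdinaryAt W p →
      ∀ {N : ℕ} [NeZero N] (f : CuspForm (CongruenceSubgroup.Gamma0 N) 2),
        Literature.NumberTheory.EllipticCurves.ModularForms.IsNewformOf W f →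
        W.mordellWeilRank = 1 → Odd W.analyticRank → 3 ≤ W.analyticRank →
          PowerSeries.coeff 1 (Literature.NumberTheory.EllipticCurves.padicLFunction f
            (Literature.NumberTheory.EllipticCurves.unitRoot W p : ℚ_[p])) = 0)
    (hS1b : ∀ (W : WeierstrassCurve ℚ) [W.IsElliptic] [W.IsGloballyMinimal] (p : ℕ) [Fact p.Prime],
      5 ≤ p → Literature.NumberTheory.EllipticCurves.IsOrdinaryAt W p →
      ∀ {N : ℕ} [NeZero N] (f : CuspForm (CongruenceSubgroup.Gamma0 N) 2),
        Literature.NumberTheory.EllipticCurves.ModularForms.IsNewformOf W f →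
        2 ≤ W.mordellWeilRank → W.mordellWeilRank < W.analyticRank →
          (Even W.mordellWeilRank ↔ Even W.analyticRank) →
          PowerSeries.coeff W.mordellWeilRank (Literature.NumberTheory.EllipticCurves.padicLFunction f
            (Literature.NumberTheory.EllipticCurves.unitRoot W p : ℚ_[p])) = 0)
    (hS2 : ∀ (W : WeierstrassCurve ℚ) [W.IsElliptic] [W.IsGloballyMinimal] (p : ℕ) [Fact p.Prime],
      5 ≤ p → Literature.NumberTheory.EllipticCurves.IsOrdinaryAt W p →
      ∀ (D : WeierstrassCurve.PAdicHeightData W p), D.IsCanonical →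
      ∀ ⦃N : ℕ⦄ [NeZero N] (f : CuspForm (CongruenceSubgroup.Gamma0 N) 2),
        Literature.NumberTheory.EllipticCurves.ModularForms.IsNewformOf W f →
        2 ≤ W.mordellWeilRank → W.analyticRank = W.mordellWeilRank →
          0 < W.regulator ∧ 0 < Literature.NumberTheory.EllipticCurves.ModularForms.plusPeriod f ∧
          ∃ q : ℚ, iteratedDeriv W.mordellWeilRank W.entireLFunction 1 =
              (((W.mordellWeilRank.factorial : ℝ) * (q : ℝ) *
                Literature.NumberTheory.EllipticCurves.ModularForms.plusPeriod f * W.regulator : ℝ) : ℂ) ∧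
            PowerSeries.coeff W.mordellWeilRank (Literature.NumberTheory.EllipticCurves.padicLFunction f
                (Literature.NumberTheory.EllipticCurves.unitRoot W p : ℚ_[p])) *
              Literature.NumberTheory.EllipticCurves.padicLog p
                (Literature.NumberTheory.EllipticCurves.cyclotomicGenerator p) ^ W.mordellWeilRank =
            (q : ℚ_[p]) * (1 - (Literature.NumberTheory.EllipticCurves.unitRoot W p : ℚ_[p])⁻¹) ^ 2 *
              WeierstrassCurve.padicRegulator D) :
    ConsistencyOfKato :=
  leadingTerm_consistencyOfKato_iff_stubs.mpr fun _ _ _ => ⟨hS1a, hS1b, hS2⟩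

/-- **`ConsistencyOfKato` from deficient vanishing and the diagonal stub.** DEFICIENT VANISHING —
in every deficient cell `1 ≤ r_MW < r_an`, at every good ordinary `p ≥ 5`, `[T^{r_MW}]L_p(E,T) = 0`
(no height datum, no `q`, no periods: the restatement of crux #2 recommended in its lead report,
`Cruxes/Consistency/NOTES.md`, ROUTE NOTE) — covers S1a and S1b at once, so together with the
diagonal stub S2 it gives the item (`leadingTerm_consistencyOfKato_of_stubs`). [folklore] -/
theorem leadingTerm_consistencyOfKato_of_deficientVanishing_of_diagonal
    (hDV : ∀ (W : WeierstrassCurve ℚ) [W.IsElliptic] [W.IsGloballyMinimal] (p : ℕ) [Fact p.Prime],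
      5 ≤ p → Literature.NumberTheory.EllipticCurves.IsOrdinaryAt W p →
      ∀ {N : ℕ} [NeZero N] (f : CuspForm (CongruenceSubgroup.Gamma0 N) 2),
        Literature.NumberTheory.EllipticCurves.ModularForms.IsNewformOf W f →
        1 ≤ W.mordellWeilRank → W.mordellWeilRank < W.analyticRank →
          PowerSeries.coeff W.mordellWeilRank (Literature.NumberTheory.EllipticCurves.padicLFunction f
            (Literature.NumberTheory.EllipticCurves.unitRoot W p : ℚ_[p])) = 0)
    (hS2 : ∀ (W : WeierstrassCurve ℚ) [W.IsElliptic] [W.IsGloballyMinimal] (p : ℕ) [Fact p.Prime],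
      5 ≤ p → Literature.NumberTheory.EllipticCurves.IsOrdinaryAt W p →
      ∀ (D : WeierstrassCurve.PAdicHeightData W p), D.IsCanonical →
      ∀ ⦃N : ℕ⦄ [NeZero N] (f : CuspForm (CongruenceSubgroup.Gamma0 N) 2),
        Literature.NumberTheory.EllipticCurves.ModularForms.IsNewformOf W f →
        2 ≤ W.mordellWeilRank → W.analyticRank = W.mordellWeilRank →
          0 < W.regulator ∧ 0 < Literature.NumberTheory.EllipticCurves.ModularForms.plusPeriod f ∧
          ∃ q : ℚ, iteratedDeriv W.mordellWeilRank W.entireLFunction 1 =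
              (((W.mordellWeilRank.factorial : ℝ) * (q : ℝ) *
                Literature.NumberTheory.EllipticCurves.ModularForms.plusPeriod f * W.regulator : ℝ) : ℂ) ∧
            PowerSeries.coeff W.mordellWeilRank (Literature.NumberTheory.EllipticCurves.padicLFunction f
                (Literature.NumberTheory.EllipticCurves.unitRoot W p : ℚ_[p])) *
              Literature.NumberTheory.EllipticCurves.padicLog p
                (Literature.NumberTheory.EllipticCurves.cyclotomicGenerator p) ^ W.mordellWeilRank =
            (q : ℚ_[p]) * (1 - (Literature.NumberTheory.EllipticCurves.unitRoot W p : ℚ_[p])⁻¹) ^ 2 *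
              WeierstrassCurve.padicRegulator D) :
    ConsistencyOfKato := by
  refine leadingTerm_consistencyOfKato_of_stubs ?_ ?_ hS2
  · intro W _ _ p _ h5 hord N _ f hf h1 _ h3
    have h := hDV W p h5 hord f hf (by omega) (by omega)
    rwa [h1] at h
  · intro W _ _ p _ h5 hord N _ f hf h2 hlt _
    exact hDV W p h5 hord f hf (by omega) hlt

/-- **`ConsistencyOfKato` through items: the Selmer side and the diagonal stub.** With
`KatoDivisibility` available as a premise of the item, route SelmerRank's items `SelmerRankLB`
(stmt-BirchSwinnertonDyer-0131: `r_an ≤ corank_{ℤ_p} Sel_{p^∞}(E/ℚ)` at good ordinary `p ≥ 5` with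
surjective `ρ̄_{E,p}`) and `SelmerRankSmallImage` (stmt-BirchSwinnertonDyer-14418: `corank = r_an`
otherwise) give deficient vanishing in EVERY cell `1 ≤ r_MW < r_an` — S1a and S1b at once — by
`r_MW < r_an ≤ corank Sel_{p^∞} ≤ ord_T L_p` (`deficient_coeff_eq_zero_of_items` with
`KatoCorankBound` from `leadingTerm_katoCorankBound_of_katoDivisibility`; Kato, Astérisque 295,
Thm 18.4), so the item's residue is the single diagonal stub S2 (`stub_diagonal_two_le`, the
rank-`≥ 2` `p`-adic Beilinson formula). The Kato premise is consumed INSIDE the item here, so the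
statement mentions no Kato fact. [cite: Kato2004Asterisque, Thm 18.4 (p. 281)] -/
theorem leadingTerm_consistencyOfKato_of_selmerSide_of_diagonal
    (hLB : Summit.BirchSwinnertonDyer.BirchSwinnertonDyer.Theses.SelmerRank.SelmerRankLB)
    (hSI : Summit.BirchSwinnertonDyer.BirchSwinnertonDyer.Theses.SelmerRank.SelmerRankSmallImage)
    (hS2 : ∀ (W : WeierstrassCurve ℚ) [W.IsElliptic] [W.IsGloballyMinimal] (p : ℕ) [Fact p.Prime],
      5 ≤ p → Literature.NumberTheory.EllipticCurves.IsOrdinaryAt W p →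
      ∀ (D : WeierstrassCurve.PAdicHeightData W p), D.IsCanonical →
      ∀ ⦃N : ℕ⦄ [NeZero N] (f : CuspForm (CongruenceSubgroup.Gamma0 N) 2),
        Literature.NumberTheory.EllipticCurves.ModularForms.IsNewformOf W f →
        2 ≤ W.mordellWeilRank → W.analyticRank = W.mordellWeilRank →
          0 < W.regulator ∧ 0 < Literature.NumberTheory.EllipticCurves.ModularForms.plusPeriod f ∧
          ∃ q : ℚ, iteratedDeriv W.mordellWeilRank W.entireLFunction 1 =
              (((W.mordellWeilRank.factorial : ℝ) * (q : ℝ) *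
                Literature.NumberTheory.EllipticCurves.ModularForms.plusPeriod f * W.regulator : ℝ) : ℂ) ∧
            PowerSeries.coeff W.mordellWeilRank (Literature.NumberTheory.EllipticCurves.padicLFunction f
                (Literature.NumberTheory.EllipticCurves.unitRoot W p : ℚ_[p])) *
              Literature.NumberTheory.EllipticCurves.padicLog p
                (Literature.NumberTheory.EllipticCurves.cyclotomicGenerator p) ^ W.mordellWeilRank =
            (q : ℚ_[p]) * (1 - (Literature.NumberTheory.EllipticCurves.unitRoot W p : ℚ_[p])⁻¹) ^ 2 *
              WeierstrassCurve.padicRegulator D) :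
    ConsistencyOfKato := by
  -- the Kato premise of the item is needed for deficient vanishing, so we cannot go through
  -- `leadingTerm_consistencyOfKato_of_deficientVanishing_of_diagonal` verbatim: unfold instead
  unfold ConsistencyOfKato
  intro hK hUB hR1
  have hKC : KatoCorankBound := leadingTerm_katoCorankBound_of_katoDivisibility hK
  have hdef := deficient_coeff_eq_zero_of_items hLB hSI hKC
  exact leadingTerm_consistencyOfKato_of_deficientVanishing_of_diagonal hdef hS2 hK hUB hR1

end Summit.BirchSwinnertonDyer.BirchSwinnertonDyer.Theorems
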